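import Literature.MathematicalPhysics.QuantumLattice.HubbardGridCounterQuadratic
import Literature.MathematicalPhysics.QuantumLattice.HubbardShiftedSliceSymbolDifferences
import Literature.MathematicalPhysics.QuantumLattice.HubbardShiftedCovarianceDecomposition
import Literature.MathematicalPhysics.QuantumLattice.GrassmannGaussianQuadraticInsertion
import HarnessLib

/-!
# The momentum-space density `N̂ = (βL²)⁻¹ Σ_{kσ} ψ̂⁺_{kσ}ψ̂⁻_{kσ}`: the image of the grid-local quadratic term, and the exact
# renormalisation of the (complex-shifted) free covariance by `e^{w N̂}` — a chemical-potential shift by `w ∈ ℂ`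

Topic `MathematicalPhysics/QuantumLattice`; cell gate-hubbard-kl, R0-SCOPE-4 P7 (representation identities).  Two exact identities on the
finite Grassmann algebra of the Hubbard torus with `M` Matsubara pairs:
* `map_hubbardGridSub_gridQuadratic` — the grid-local density `N₂ = (β/N)Σ ψ⁺ψ⁻(x⃗, jβ/N)` (`hubbardGridQuadratic`) is pulled back by the
  grid substitution onto `momentumDensity = (βL²)⁻¹Σ_{kσ} ψ̂⁺_{kσ}ψ̂⁻_{kσ}` for `2M ≤ N` (time and space orthogonality, as for the
  counterterm vertex in `HubbardGridCounterQuadratic`);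
* `gaussExpect_shifted_grassmannExp_smul_momentumDensity_mul` — for the sharp shifted covariance `C^θ_{μ_R} = normalCovariance (p_θ)`,
  `|βθ| ≤ π/4`, and any `w ∈ ℂ` with `|β(θ + Im w)| ≤ π/4`,
  `∫ dμ_{C^θ_{μ_R}} e^{w N̂} F = (∫ dμ_{C^θ_{μ_R}} e^{w N̂}) · ∫ dμ_{C^{θ + Im w}_{μ_R + Re w}} F`:
  a quadratic insertion `e^{wN̂}` is a (complex) shift of the chemical potential of the covariance
  (`GrassmannGaussianQuadraticInsertion.gaussExpect_grassmannExp_mul_of_transpose_eq_neg`, with `(1 + C S)⁻¹ C` computed from the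
  algebra of normal-form matrices: `S = normalCovariance (w/(βL²))`, `nC(p)·nC(q) = -diag(pq)`, `diag(d)·nC(p) = nC(dp)`, and
  `p/(1 - pw/(βL²)) = βL²/(-i(ω+θ) + ξ - w)`), and the normalisation never vanishes
  (`gaussExpect_shifted_grassmannExp_smul_momentumDensity_ne_zero`, by inserting `e^{-wN̂}`).
This is Benfatto–Giuliani–Mastropietro's (2.21)–(2.24) (the quadratic part moved into the free measure) in exact finite-`M` form, for
complex shifts (Hartree counterterm of a complex coupling).

Everything is proved; `momentumDensity` is the only definition; no named facts.

## Sources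

G. Benfatto, A. Giuliani, V. Mastropietro, Ann. Henri Poincaré 7 (2006) 809–898, §2.1 (2.5)–(2.6a), §2.3 (2.21)–(2.24)
(`BenfattoGiulianiMastropietro2006`); M. Salmhofer, *Renormalization* (1999), §4.2.4 (4.59) (`Salmhofer1999`).
-/

noncomputable section

namespace Literature.MathematicalPhysics.QuantumLattice

open GrassmannAlgebra Finset Literature.Probability.LatticeModels Complex
open scoped ComplexConjugate

variable (L M : ℕ) [NeZero L]

/-- **The momentum-space density** `N̂ = (βL²)⁻¹ Σ_{k,σ} ψ̂⁺_{kσ} ψ̂⁻_{kσ}`. [cite: BenfattoGiulianiMastropietro2006, §2.3 (2.22)] -/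
def momentumDensity (β : ℝ) : HubbardGrassmann L M :=
  ∑ k : FreqMomentum L M, ∑ σ : Fin 2, ((1 / (β * (L : ℝ) ^ 2) : ℝ) : ℂ) • (psiPlus k σ * psiMinus k σ)

variable {L M} {N : ℕ}

/-! ### The grid density is pulled back onto `N̂` -/

/-- The image of one grid monomial. [cite: BenfattoGiulianiMastropietro2006, §2.1 (2.5)] -/
theorem map_hubbardGridSub_gridPair (β : ℝ) (p : GridPoint L N) (σ : Fin 2) :
    ExteriorAlgebra.map (Matrix.toLin' (hubbardGridSub L M β N))
        (gen ℂ (((p, σ), 0) : GridLeg (GridPoint L N)) * gen ℂ (((p, σ), 1) : GridLeg (GridPoint L N))) =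
      ∑ k : FreqMomentum L M, ∑ k' : FreqMomentum L M,
        ((((1 / (β * (L : ℝ) ^ 2) : ℝ) : ℂ) * conj (vertexPlaneWave L M β 0 k p.2 (gridTime β N p.1))) *
          (((1 / (β * (L : ℝ) ^ 2) : ℝ) : ℂ) * conj (vertexPlaneWave L M β 1 k' p.2 (gridTime β N p.1)))) •
          (psiPlus k σ * psiMinus k' σ) := by
  rw [map_mul, hubbardGridSub, map_gridSub_gen, map_gridSub_gen, positionField_mul_positionField]
  rfl

/-- **`map (toLin' S_N) N₂ = N̂`** for `2M ≤ N`, `β ≠ 0`. [cite: Salmhofer1999, §4.2.4 (4.59)] -/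
theorem map_hubbardGridSub_gridQuadratic {β : ℝ} (hβ : β ≠ 0) (hN : 2 * M ≤ N) [NeZero N] :
    ExteriorAlgebra.map (Matrix.toLin' (hubbardGridSub L M β N)) (hubbardGridQuadratic L N β) = momentumDensity L M β := by
  have hNc : (N : ℂ) ≠ 0 := by exact_mod_cast NeZero.ne N
  have hLc : (L : ℂ) ≠ 0 := by exact_mod_cast NeZero.ne L
  have hβc : (β : ℂ) ≠ 0 := by exact_mod_cast hβ
  -- the coefficient of `ψ̂⁺_{kσ} ψ̂⁻_{k'σ}` from the grid point `p`
  set F : FreqMomentum L M → FreqMomentum L M → GridPoint L N → ℂ := fun k k' p =>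
    (((1 / (β * (L : ℝ) ^ 2) : ℝ) : ℂ) * conj (vertexPlaneWave L M β 0 k p.2 (gridTime β N p.1))) *
      (((1 / (β * (L : ℝ) ^ 2) : ℝ) : ℂ) * conj (vertexPlaneWave L M β 1 k' p.2 (gridTime β N p.1))) with hF
  -- the grid sum of `F` is the constraint
  have hsumF : ∀ k k' : FreqMomentum L M, ∑ p : GridPoint L N, F k k' p =
      if k' = k then ((1 / (β * (L : ℝ) ^ 2) : ℝ) : ℂ) ^ 2 * ((N : ℂ) * (L : ℂ) ^ 2) else 0 := by
    intro k k'
    have hfac : ∀ p : GridPoint L N, F k k' p = ((1 / (β * (L : ℝ) ^ 2) : ℝ) : ℂ) ^ 2 *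
        (conj (vertexPlaneWave L M β 0 k p.2 (gridTime β N p.1)) * conj (vertexPlaneWave L M β 1 k' p.2 (gridTime β N p.1))) := by
      intro p; rw [hF]; ring
    simp_rw [hfac]
    rw [← mul_sum, Fintype.sum_prod_type, sum_comm]
    simp_rw [sum_conj_vertexPlaneWave_zero_mul_one_gridTime hβ hN]
    rw [← mul_sum]
    simp_rw [← torusChar_sub_left]
    rw [sum_torusChar_right]
    by_cases hk : k' = k
    · subst hk; simp
    · rw [if_neg hk]
      by_cases h1 : k.1 = k'.1
      · have h2 : k.2 - k'.2 ≠ 0 := fun h => hk (Prod.ext h1.symm (sub_eq_zero.1 h).symm)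
        rw [if_neg h2, mul_zero, mul_zero]
      · rw [if_neg h1, zero_mul, mul_zero]
  -- expand
  rw [hubbardGridQuadratic, map_smul, map_sum]
  simp_rw [map_sum, map_hubbardGridSub_gridPair]
  -- reorder: `p` innermost
  have hreorg : ∑ p : GridPoint L N, ∑ σ : Fin 2, ∑ k : FreqMomentum L M, ∑ k' : FreqMomentum L M, F k k' p • (psiPlus k σ * psiMinus k' σ) =
      ∑ σ : Fin 2, ∑ k : FreqMomentum L M, ∑ k' : FreqMomentum L M, (∑ p : GridPoint L N, F k k' p) • (psiPlus k σ * psiMinus k' σ) := by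
    calc ∑ p : GridPoint L N, ∑ σ : Fin 2, ∑ k : FreqMomentum L M, ∑ k' : FreqMomentum L M, F k k' p • (psiPlus k σ * psiMinus k' σ)
        = ∑ σ : Fin 2, ∑ p : GridPoint L N, ∑ k : FreqMomentum L M, ∑ k' : FreqMomentum L M, F k k' p • (psiPlus k σ * psiMinus k' σ) :=
          Finset.sum_comm
      _ = ∑ σ : Fin 2, ∑ k : FreqMomentum L M, ∑ p : GridPoint L N, ∑ k' : FreqMomentum L M, F k k' p • (psiPlus k σ * psiMinus k' σ) :=
          Finset.sum_congr rfl fun σ _ => Finset.sum_comm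
      _ = ∑ σ : Fin 2, ∑ k : FreqMomentum L M, ∑ k' : FreqMomentum L M, ∑ p : GridPoint L N, F k k' p • (psiPlus k σ * psiMinus k' σ) :=
          Finset.sum_congr rfl fun σ _ => Finset.sum_congr rfl fun k _ => Finset.sum_comm
      _ = _ := Finset.sum_congr rfl fun σ _ => Finset.sum_congr rfl fun k _ => Finset.sum_congr rfl fun k' _ => (Finset.sum_smul).symm
  have hF' : ∀ (p : GridPoint L N) (σ : Fin 2) (k k' : FreqMomentum L M),
      ((((1 / (β * (L : ℝ) ^ 2) : ℝ) : ℂ) * conj (vertexPlaneWave L M β 0 k p.2 (gridTime β N p.1))) *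
        (((1 / (β * (L : ℝ) ^ 2) : ℝ) : ℂ) * conj (vertexPlaneWave L M β 1 k' p.2 (gridTime β N p.1)))) • (psiPlus k σ * psiMinus k' σ) =
      F k k' p • (psiPlus k σ * psiMinus k' σ) := fun _ _ _ _ => rfl
  simp_rw [hF']
  rw [hreorg]
  -- collapse the `k'`-sum with the constraint
  have hcollapse : ∀ (σ : Fin 2) (k : FreqMomentum L M),
      ∑ k' : FreqMomentum L M, (∑ p : GridPoint L N, F k k' p) • (psiPlus k σ * psiMinus k' σ) =
        (((1 / (β * (L : ℝ) ^ 2) : ℝ) : ℂ) ^ 2 * ((N : ℂ) * (L : ℂ) ^ 2)) • (psiPlus k σ * psiMinus k σ) := by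
    intro σ k
    simp_rw [hsumF, ite_smul, zero_smul]
    rw [sum_ite_eq' univ k, if_pos (mem_univ _)]
  simp_rw [hcollapse]
  rw [momentumDensity, Finset.sum_comm, Finset.smul_sum]
  refine Finset.sum_congr rfl fun k _ => ?_
  rw [Finset.smul_sum]
  refine Finset.sum_congr rfl fun σ _ => ?_
  rw [smul_smul]
  congr 1
  push_cast
  field_simp

/-! ### Normal-form matrix algebra -/

/-- The product of two normal-form matrices is minus the diagonal of the products of the symbols.
[cite: BenfattoGiulianiMastropietro2006, §2.3 (2.23)] -/
theorem normalCovariance_mul_normalCovariance (p q : FreqMomentum L M × Fin 2 → ℂ) :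
    normalCovariance L M p * normalCovariance L M q = -Matrix.diagonal fun X : HubbardFieldIdx L M => p X.1 * q X.1 := by
  classical
  ext X Z
  obtain ⟨ks, c⟩ := X
  obtain ⟨ks', c'⟩ := Z
  rw [Matrix.mul_apply, Matrix.neg_apply, Matrix.diagonal_apply, Fintype.sum_prod_type]
  -- only `Y.1 = ks` contributes
  rw [Finset.sum_eq_single ks]
  · rw [Fin.sum_univ_two]
    fin_cases c <;> fin_cases c' <;> by_cases h : ks = ks' <;> simp [normalCovariance_apply, h]
  · intro ks'' _ hne
    refine sum_eq_zero fun c'' _ => ?_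
    rw [show normalCovariance L M p (ks, c) (ks'', c'') = 0 from by rw [normalCovariance_apply, if_neg (Ne.symm hne)], zero_mul]
  · intro h; exact absurd (mem_univ _) h

/-- A diagonal matrix constant on each label `ks` times a normal-form matrix is the normal-form matrix of the product symbol.
[cite: BenfattoGiulianiMastropietro2006, §2.3 (2.23)] -/
theorem diagonal_mul_normalCovariance (d p : FreqMomentum L M × Fin 2 → ℂ) :
    (Matrix.diagonal fun X : HubbardFieldIdx L M => d X.1) * normalCovariance L M p = normalCovariance L M fun ks => d ks * p ks := by
  ext X Y
  rw [Matrix.diagonal_mul, normalCovariance_apply, normalCovariance_apply]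
  split_ifs <;> ring

omit [NeZero L] in
/-- The antisymmetrised coefficient matrix of `wN̂` is the normal-form matrix of the constant symbol `w/(βL²)`.
[cite: BenfattoGiulianiMastropietro2006, §2.3 (2.22)] -/
theorem densitySkew_eq (β : ℝ) (w : ℂ) :
    (Matrix.of fun X Y : HubbardFieldIdx L M =>
        (if X.1 = Y.1 ∧ X.2 = 0 ∧ Y.2 = 1 then w * (((1 / (β * (L : ℝ) ^ 2) : ℝ)) : ℂ) else 0) -
          (if Y.1 = X.1 ∧ Y.2 = 0 ∧ X.2 = 1 then w * (((1 / (β * (L : ℝ) ^ 2) : ℝ)) : ℂ) else 0)) =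
      normalCovariance L M fun _ => w * (((1 / (β * (L : ℝ) ^ 2) : ℝ)) : ℂ) := by
  ext X Y
  rw [Matrix.of_apply, normalCovariance_apply]
  rcases Fin.exists_fin_two.1 ⟨X.2, rfl⟩ with hX | hX <;> rcases Fin.exists_fin_two.1 ⟨Y.2, rfl⟩ with hY | hY <;>
    by_cases h : X.1 = Y.1 <;> simp [hX, hY, h, eq_comm]

/-- `wN̂` as a quadratic form in the generators. [cite: BenfattoGiulianiMastropietro2006, §2.3 (2.22)] -/
theorem smul_momentumDensity_eq_sum (β : ℝ) (w : ℂ) :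
    w • momentumDensity L M β = ∑ X : HubbardFieldIdx L M, ∑ Y : HubbardFieldIdx L M,
      (if X.1 = Y.1 ∧ X.2 = 0 ∧ Y.2 = 1 then w * (((1 / (β * (L : ℝ) ^ 2) : ℝ)) : ℂ) else 0) • (gen ℂ X * gen ℂ Y) := by
  classical
  -- right-hand side: for each `X = (ks, 0)` only `Y = (ks, 1)` survives; `X = (ks, 1)` gives nothing
  have hY : ∀ X : HubbardFieldIdx L M, ∑ Y : HubbardFieldIdx L M,
      (if X.1 = Y.1 ∧ X.2 = 0 ∧ Y.2 = 1 then w * (((1 / (β * (L : ℝ) ^ 2) : ℝ)) : ℂ) else 0) • (gen ℂ X * gen ℂ Y) =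
      if X.2 = 0 then (w * (((1 / (β * (L : ℝ) ^ 2) : ℝ)) : ℂ)) • (gen ℂ X * gen ℂ ((X.1, 1) : HubbardFieldIdx L M)) else 0 := by
    intro X
    split_ifs with hX
    · rw [Finset.sum_eq_single ((X.1, 1) : HubbardFieldIdx L M)]
      · simp [hX]
      · intro Y _ hne
        have : ¬ (X.1 = Y.1 ∧ X.2 = 0 ∧ Y.2 = 1) := by
          rintro ⟨h1, -, h3⟩; exact hne (Prod.ext h1.symm h3)
        rw [if_neg this, zero_smul]
      · intro h; exact absurd (mem_univ _) h
    · exact sum_eq_zero fun Y _ => by rw [if_neg (fun h => hX h.2.1), zero_smul]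
  simp_rw [hY]
  rw [Fintype.sum_prod_type]
  simp only [Fin.sum_univ_two, Fin.isValue, if_true, one_ne_zero, if_false, add_zero]
  rw [momentumDensity, smul_sum]
  simp_rw [smul_sum, smul_smul]
  rw [← Fintype.sum_prod_type']
  refine Fintype.sum_congr _ _ fun ks => ?_
  obtain ⟨k, σ⟩ := ks
  rfl

/-! ### The insertion theorem -/

/-- **The shifted symbols**: for `|βθ| ≤ π/4` and `|β(θ + Im w)| ≤ π/4`, with `c = 1/(βL²)` and `p = p^θ_{μ_R}`,
`1 - p(k) w c ≠ 0` and `p(k)/(1 - p(k) w c) = p^{θ + Im w}_{μ_R + Re w}(k)`. [cite: BenfattoGiulianiMastropietro2006, §2.3 (2.23)] -/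
theorem shiftedFreeSymbol_div_eq {β : ℝ} (hβ : 0 < β) (μR : ℝ) {θ : ℝ} (hθ : |β * θ| ≤ Real.pi / 4) {w : ℂ}
    (hw : |β * (θ + w.im)| ≤ Real.pi / 4) (ks : FreqMomentum L M × Fin 2) :
    1 - shiftedFreeSymbol L M β μR θ ks * (w * (((1 / (β * (L : ℝ) ^ 2) : ℝ)) : ℂ)) ≠ 0 ∧
      shiftedFreeSymbol L M β μR θ ks / (1 - shiftedFreeSymbol L M β μR θ ks * (w * (((1 / (β * (L : ℝ) ^ 2) : ℝ)) : ℂ))) =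
        shiftedFreeSymbol L M β (μR + w.re) (θ + w.im) ks := by
  have hL : (0 : ℝ) < L := by exact_mod_cast Nat.pos_of_ne_zero (NeZero.ne L)
  -- nonvanishing of the two real denominators
  have hden : ∀ t : ℝ, |β * t| ≤ Real.pi / 4 → ∀ μ' : ℝ, (matsubaraFreq β M ks.1.1 + t) ^ 2 + nambuXi L μ' ks.1.2 ^ 2 ≠ 0 := by
    intro t ht μ' h
    have hω := pi_div_le_abs_matsubaraFreq hβ ks.1.1
    have ht' : |t| < Real.pi / β := by
      rw [abs_mul, abs_of_pos hβ] at ht; rw [lt_div_iff₀ hβ]; nlinarith [Real.pi_pos, abs_nonneg t]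
    have h1 : matsubaraFreq β M ks.1.1 + t = 0 := by nlinarith [sq_nonneg (nambuXi L μ' ks.1.2), sq_nonneg (matsubaraFreq β M ks.1.1 + t)]
    have : |matsubaraFreq β M ks.1.1| = |t| := by rw [show matsubaraFreq β M ks.1.1 = -t by linarith, abs_neg]
    linarith
  have hd1 := hden θ hθ μR
  have hd2 := hden (θ + w.im) hw (μR + w.re)
  set d1 : ℂ := -Complex.I * ((matsubaraFreq β M ks.1.1 + θ : ℝ) : ℂ) + (nambuXi L μR ks.1.2 : ℂ) with hd1def
  set d2 : ℂ := -Complex.I * ((matsubaraFreq β M ks.1.1 + (θ + w.im) : ℝ) : ℂ) + (nambuXi L (μR + w.re) ks.1.2 : ℂ) with hd2def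
  have hne : ∀ (t μ' : ℝ), (matsubaraFreq β M ks.1.1 + t) ^ 2 + nambuXi L μ' ks.1.2 ^ 2 ≠ 0 →
      (-Complex.I * ((matsubaraFreq β M ks.1.1 + t : ℝ) : ℂ) + (nambuXi L μ' ks.1.2 : ℂ)) ≠ 0 := by
    intro t μ' h hz
    apply h
    have hre := congrArg Complex.re hz
    have him := congrArg Complex.im hz
    simp at hre him
    have ht : matsubaraFreq β M ks.1.1 + t = 0 := by linarith
    rw [ht, hre]; ring
  have hd1ne : d1 ≠ 0 := hne θ μR hd1
  have hd2ne : d2 ≠ 0 := hne (θ + w.im) (μR + w.re) hd2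
  have hold : shiftedFreeSymbol L M β μR θ ks = ((β * (L : ℝ) ^ 2 : ℝ) : ℂ) / d1 := shiftedFreeSymbol_eq_div β μR θ ks hd1
  have hnew : shiftedFreeSymbol L M β (μR + w.re) (θ + w.im) ks = ((β * (L : ℝ) ^ 2 : ℝ) : ℂ) / d2 :=
    shiftedFreeSymbol_eq_div β (μR + w.re) (θ + w.im) ks hd2
  have hrel : d2 = d1 - w := by
    apply Complex.ext
    · simp [hd1def, hd2def, nambuXi]; ring
    · simp [hd1def, hd2def]; ring
  have hβL : ((β * (L : ℝ) ^ 2 : ℝ) : ℂ) ≠ 0 := by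
    have : (0 : ℝ) < β * (L : ℝ) ^ 2 := by positivity
    exact_mod_cast this.ne'
  have hkey : 1 - shiftedFreeSymbol L M β μR θ ks * (w * (((1 / (β * (L : ℝ) ^ 2) : ℝ)) : ℂ)) = d2 / d1 := by
    rw [hold, hrel]
    have hβc : (β : ℂ) ≠ 0 := by exact_mod_cast hβ.ne'
    have hLc : (L : ℂ) ≠ 0 := by exact_mod_cast (NeZero.ne L)
    push_cast
    field_simp
  refine ⟨by rw [hkey]; exact div_ne_zero hd2ne hd1ne, ?_⟩
  rw [hkey, hnew, hold]
  field_simp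

/-- **The insertion `e^{wN̂}` shifts the chemical potential**: for `|βθ| ≤ π/4` and `|β(θ + Im w)| ≤ π/4`,
`∫dμ_{C^θ_{μ_R}} e^{wN̂} F = (∫dμ_{C^θ_{μ_R}} e^{wN̂}) · ∫dμ_{C^{θ+Im w}_{μ_R+Re w}} F`. [cite: BenfattoGiulianiMastropietro2006, §2.3 (2.23)-(2.24)] -/
theorem gaussExpect_shifted_grassmannExp_smul_momentumDensity_mul {β : ℝ} (hβ : 0 < β) (μR : ℝ) {θ : ℝ}
    (hθ : |β * θ| ≤ Real.pi / 4) {w : ℂ} (hw : |β * (θ + w.im)| ≤ Real.pi / 4) (F : HubbardGrassmann L M) :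
    gaussExpect ℂ (hubbardCovFullShifted L M β μR θ) (grassmannExp (w • momentumDensity L M β) * F) =
      gaussExpect ℂ (hubbardCovFullShifted L M β μR θ) (grassmannExp (w • momentumDensity L M β)) *
        gaussExpect ℂ (hubbardCovFullShifted L M β (μR + w.re) (θ + w.im)) F := by
  classical
  set p := shiftedFreeSymbol L M β μR θ with hp
  set c : ℂ := w * (((1 / (β * (L : ℝ) ^ 2) : ℝ)) : ℂ) with hc
  set Nw : Matrix (HubbardFieldIdx L M) (HubbardFieldIdx L M) ℂ :=
    Matrix.of fun X Y => if X.1 = Y.1 ∧ X.2 = 0 ∧ Y.2 = 1 then c else 0 with hNw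
  set Mw : Matrix (HubbardFieldIdx L M) (HubbardFieldIdx L M) ℂ := Matrix.diagonal fun X => (1 - p X.1 * c)⁻¹ with hMw
  have hq : w • momentumDensity L M β = ∑ X, ∑ Y, Nw X Y • (gen ℂ X * gen ℂ Y) := by
    rw [smul_momentumDensity_eq_sum]; rfl
  have hC : (hubbardCovFullShifted L M β μR θ).transpose = -hubbardCovFullShifted L M β μR θ := normalCovariance_transpose _
  have hS : normalCovariance L M (fun _ => c) = Matrix.of fun X Y => Nw X Y - Nw Y X := by
    rw [← densitySkew_eq β w]
    ext X Y
    simp only [Matrix.of_apply, hNw, hc]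
  have hden := fun ks => shiftedFreeSymbol_div_eq (L := L) (M := M) hβ μR hθ hw ks
  have hM : Mw * (1 + hubbardCovFullShifted L M β μR θ * (Matrix.of fun X Y => Nw X Y - Nw Y X)) = 1 := by
    rw [← hS, hubbardCovFullShifted, normalCovariance_mul_normalCovariance, ← sub_eq_add_neg]
    have : (1 : Matrix (HubbardFieldIdx L M) (HubbardFieldIdx L M) ℂ) - Matrix.diagonal (fun X : HubbardFieldIdx L M => p X.1 * c) =
        Matrix.diagonal fun X => 1 - p X.1 * c := by
      rw [← Matrix.diagonal_one, ← Matrix.diagonal_sub]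
    rw [← hp, this, hMw, Matrix.diagonal_mul_diagonal, ← Matrix.diagonal_one]
    congr 1
    funext X
    exact inv_mul_cancel₀ (hden X.1).1
  have hMC : Mw * hubbardCovFullShifted L M β μR θ = hubbardCovFullShifted L M β (μR + w.re) (θ + w.im) := by
    rw [hubbardCovFullShifted, hubbardCovFullShifted, ← hp, hMw,
      diagonal_mul_normalCovariance (fun ks : FreqMomentum L M × Fin 2 => (1 - p ks * c)⁻¹) p]
    congr 1
    funext ks
    rw [← (hden ks).2, div_eq_inv_mul]
  have h := gaussExpect_grassmannExp_mul_of_transpose_eq_neg Nw hq hC rfl hM F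
  rwa [hMC] at h

/-- **The normalisation never vanishes**: `∫dμ_{C^θ_{μ_R}} e^{wN̂} ≠ 0` (insert `F = e^{-wN̂}`).
[cite: BenfattoGiulianiMastropietro2006, §2.3 (2.24)] -/
theorem gaussExpect_shifted_grassmannExp_smul_momentumDensity_ne_zero {β : ℝ} (hβ : 0 < β) (μR : ℝ) {θ : ℝ}
    (hθ : |β * θ| ≤ Real.pi / 4) {w : ℂ} (hw : |β * (θ + w.im)| ≤ Real.pi / 4) :
    gaussExpect ℂ (hubbardCovFullShifted L M β μR θ) (grassmannExp (w • momentumDensity L M β)) ≠ 0 := by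
  intro h0
  have h := gaussExpect_shifted_grassmannExp_smul_momentumDensity_mul (L := L) (M := M) hβ μR hθ hw (grassmannExp (-(w • momentumDensity L M β)))
  rw [h0, zero_mul] at h
  -- `e^{wN̂} e^{-wN̂} = 1`
  have hq := smul_momentumDensity_eq_sum (L := L) (M := M) β w
  have hnil : IsNilpotent (w • momentumDensity L M β) := isNilpotent_of_eq_quadratic _ hq
  have hnil' : IsNilpotent (-(w • momentumDensity L M β)) := hnil.neg
  have hcomm : Commute (w • momentumDensity L M β) (-(w • momentumDensity L M β)) := (Commute.refl _).neg_right
  have hone : grassmannExp (w • momentumDensity L M β) * grassmannExp (-(w • momentumDensity L M β)) = 1 := by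
    rw [grassmannExp, grassmannExp, ← IsNilpotent.exp_add_of_commute hcomm hnil hnil', add_neg_cancel, IsNilpotent.exp_zero]
  rw [hone, gaussExpect_one] at h
  exact one_ne_zero h

end Literature.MathematicalPhysics.QuantumLattice

end
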